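import Mathlib.LinearAlgebra.FiniteDimensional.Lemmas
import Literature.Computability.AlgebraicComplexity.GKSS19HardnessToHittingSets
import HarnessLib

/-!
# Guo–Kumar–Saptharishi–Solomon ‹Theorem 15› (Heintz–Schnorr 1980 / Agrawal 2005): a hitting set of
# fewer than `(d'+1)^k` points admits a nonzero low-degree annihilator, which is therefore hard —
# proof of the named fact `GKSS2019_thm_15`

Topic `Literature/Computability/AlgebraicComplexity`; theorem-only companion of
`GKSS19HardnessToHittingSets.lean` (cell `val-lit`, seat x6). HONEST FRAMING: an elementary published
lemma re-proved in the kernel; `VP ≠ VNP` is NOT proved and nothing here bears on it.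

**Printed statement** (Guo–Kumar–Saptharishi–Solomon, arXiv:1905.00091 ‹Thm 15› = ECCC TR19-065r2
Thm 2.3, attributed to [HS80], [A05a]): "Let `H(n, i-deg: d, s)` be an explicit hitting set for the
class `𝒞(n, i-deg: d, s)`. Then, for every `k ≤ n` and `d'` such that `d' ≤ d` and
`(d'+1)^k > |H|`, there is a nonzero polynomial on `k` variables and individual degree `d'` that
vanishes on the hitting set, and hence cannot be computed by a circuit of size `s`."

**Proof (the printed one-liner, "dimension counting").** The polynomials in `x_0, …, x_{k-1}` of
individual degree `≤ d'` form the span `V` of the `(d'+1)^k` monomials `x^e`, `e ∈ {0..d'}^k × {0}^{n-k}`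
(Mathlib `MvPolynomial.restrictSupport` with its monomial basis `basisRestrictSupport`, so
`finrank V = (d'+1)^k`); evaluation at the points of `H` is a linear map `V → F^H` into a space of
dimension `|H| < (d'+1)^k`, so its kernel contains a nonzero `g` (`LinearMap.ker_ne_bot_of_finrank_lt`).
Such a `g` vanishes on `H`; if it had a circuit of size `≤ s` it would lie in `𝒞(n, i-deg: d, s)`
(its individual degrees are `≤ d' ≤ d`) and the hitting set would hit it — contradiction.

## References
* [GuoKumarSaptharishiSolomon2019] ‹Thm 15› (arXiv p0009.txt:L47-48; = ECCC TR19-065r2 Thm 2.3, p.10).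
* [HeintzSchnorr1980] J. Heintz, C.-P. Schnorr, *Testing polynomials which are easy to compute*,
  STOC 1980, Thm. 4.4; M. Agrawal, *Proving lower bounds via pseudo-random generators*, FSTTCS 2005.
-/

noncomputable section

open MvPolynomial

namespace Literature.Computability.AlgebraicComplexity

open GKSS2019 HittingSets

/-- **GKSS ‹Thm 15› (Heintz–Schnorr / Agrawal), PROVED**: a hitting set with `|H| < (d'+1)^k`,
`k ≤ n`, `d' ≤ d`, for `𝒞(n, i-deg: d, s)` yields a nonzero polynomial in the first `k` variables of
individual degree `≤ d'` that vanishes on `H` and has circuit complexity `> s`.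
[cite: GuoKumarSaptharishiSolomon2019, Thm 15 (arXiv p0009.txt:L47-48; = ECCC TR19-065r2 Thm 2.3, p.10)] -/
theorem GKSS2019_thm_15_holds : GKSS2019_thm_15 := by
  intro F _ n d k d' s H hH hk hd' hcard
  classical
  -- the box exponents `e ∈ {0..d'}^k × {0}^{n-k}`, indexed by value vectors `v : Fin k → Fin (d'+1)`
  let φ : (Fin k → Fin (d' + 1)) → (Fin n →₀ ℕ) := fun v =>
    Finsupp.equivFunOnFinite.symm fun i => if h : i.val < k then (v ⟨i.val, h⟩ : ℕ) else 0
  have hφ : ∀ v i, φ v i = if h : i.val < k then (v ⟨i.val, h⟩ : ℕ) else 0 := fun v i => by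
    simp [φ]
  have hφle : ∀ v i, φ v i ≤ d' := fun v i => by
    rw [hφ]
    split_ifs with h
    · exact Nat.lt_succ_iff.mp (v ⟨i.val, h⟩).isLt
    · exact Nat.zero_le _
  have hφ0 : ∀ v (i : Fin n), k ≤ i.val → φ v i = 0 := fun v i hi => by
    rw [hφ, dif_neg (Nat.not_lt.mpr hi)]
  have hφinj : Function.Injective φ := by
    intro v w hvw
    funext j
    have h := congrArg (fun e : Fin n →₀ ℕ => e (Fin.castLE hk j)) hvw
    simp only [hφ, Fin.val_castLE, j.isLt, dif_pos, Fin.eta] at h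
    exact Fin.ext h
  -- the space of polynomials supported on the box, with its monomial basis
  set S : Finset (Fin n →₀ ℕ) := Finset.univ.image φ with hS
  have hScard : S.card = (d' + 1) ^ k := by
    rw [hS, Finset.card_image_of_injective _ hφinj, Finset.card_univ, Fintype.card_fun,
      Fintype.card_fin, Fintype.card_fin]
  let V : Submodule F (MvPolynomial (Fin n) F) := restrictSupport F (↑S : Set (Fin n →₀ ℕ))
  haveI : Module.Finite F V := Module.Finite.of_basis (basisRestrictSupport F (↑S : Set (Fin n →₀ ℕ)))
  have hV : Module.finrank F V = (d' + 1) ^ k := by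
    rw [Module.finrank_eq_card_basis (basisRestrictSupport F (↑S : Set (Fin n →₀ ℕ))), ← hScard]
    simp
  -- evaluation at the points of `H`
  have hW : Module.finrank F (↥H → F) = H.card := by
    rw [Module.finrank_pi, Fintype.card_coe]
  have hlt : Module.finrank F (↥H → F) < Module.finrank F V := by
    rw [hW, hV]; exact hcard
  obtain ⟨g, hgker, hg0⟩ := (Submodule.ne_bot_iff _).mp
    (LinearMap.ker_ne_bot_of_finrank_lt
      (f := (LinearMap.pi fun a : ↥H => (aeval (R := F) (a.1 : Fin n → F)).toLinearMap) ∘ₗ V.subtype)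
      hlt)
  -- unpack: `g : V`, nonzero, killed by every evaluation
  have hsupp : ∀ m ∈ (g : MvPolynomial (Fin n) F).support, m ∈ S := by
    intro m hm
    have h := (mem_restrictSupport_iff (R := F)).mp g.2 (Finset.mem_coe.mpr hm)
    exact Finset.mem_coe.mp h
  have hdeg : ∀ i, degreeOf i (g : MvPolynomial (Fin n) F) ≤ d' := by
    intro i
    rw [degreeOf_le_iff]
    intro m hm
    obtain ⟨v, -, rfl⟩ := Finset.mem_image.mp (hsupp m hm)
    exact hφle v i
  have hzero : ∀ i : Fin n, k ≤ i.val → degreeOf i (g : MvPolynomial (Fin n) F) = 0 := by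
    intro i hi
    apply Nat.le_zero.mp
    rw [degreeOf_le_iff]
    intro m hm
    obtain ⟨v, -, rfl⟩ := Finset.mem_image.mp (hsupp m hm)
    exact (hφ0 v i hi).le
  have heval : ∀ a ∈ H, eval a (g : MvPolynomial (Fin n) F) = 0 := by
    intro a ha
    have h := congrFun (LinearMap.mem_ker.mp hgker) ⟨a, ha⟩
    simp only [LinearMap.coe_comp, Function.comp_apply, LinearMap.pi_apply, Submodule.coe_subtype,
      AlgHom.toLinearMap_apply, Pi.zero_apply] at h
    exact h
  have hg0' : (g : MvPolynomial (Fin n) F) ≠ 0 := fun h => hg0 (Subtype.ext h)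
  refine ⟨g, hg0', hdeg, hzero, heval, ?_⟩
  -- hardness: otherwise `g` would be hit
  by_contra hs
  have hmem : (g : MvPolynomial (Fin n) F) ∈ idegSlice F n d s :=
    ⟨fun i => (hdeg i).trans hd', le_of_not_gt hs⟩
  obtain ⟨a, ha, hne⟩ := hH _ hmem hg0'
  exact hne (heval a (Finset.mem_coe.mp ha))

end Literature.Computability.AlgebraicComplexity

end
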